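import Literature.NumberTheory.GelbartRogawski1991.DoubledWeilRepresentationSiegelDetectionOpen
import HarnessLib

/-!
# χ-rigidity of the doubled Weil splitting under a doubled isometry, WITHOUT a continuity hypothesis
# ([GelbartRogawski1991] §3.1 Prop. 3.1.1; [Kudla1994] §3 Thm. 3.1)

Topic `NumberTheory/GelbartRogawski1991`; namespace `Literature.NumberTheory.GelbartRogawski1991.GRConstruction`
(sequel of `DoubledWeilRepresentationSiegelDetectionOpen.lean`; setting of `DoubledUnitaryGlobalSplittingData` for TWO
V-frames `dV`, `dV′` with the same `e`, `dW`).  THEOREMS ONLY; no definition, no named fact, no instance, no `sorry`.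

Data: a conjugator `r ∈ Mp(𝕎^𝔻[dV])`, a relabelling `C` with `hC : T^𝔻[dV]·C = T^𝔻[dV′]`, a group morphism
`θ : H′(𝔸) →* H(𝔸)` (`H = U(J^𝔻[dV])`, `H′ = U(J^𝔻[dV′])`), and the transported splitting
`conjSplitting r C hC (sD ∘ θ) : H′(𝔸) →* Mp(𝕎^𝔻[dV′])` (★ `AdelicMetaplecticSeesawConjugate.conjSplitting`).  Hypotheses
on `θ`: the group square `hθsq`, `hθΔ`/`hθdet` (`θ P_Δ′ ⊆ P_Δ`, `det_Δ ∘ θ = det_Δ`), `hpar` (the conjugation transports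
the `δ`-evaluation scalars), and a continuous FINITE PART `θf` with `θ (1,k) = (1, θf k)`.
* §1 `proj_conjSplitting_comp` (over `ι′^𝔻`, ★ `proj_conjSplitting_eq`);
  §2 `parabolic_conjSplitting_comp` (the `χ`-prescription on `P_Δ′(𝔸)` transports);
* §3 `isLocallyConstant_omega_conjSplitting_finAdelic` — the conjugated splitting is SMOOTH on `H′(𝔸_f)` when the source
  is (`DoubledWeilRepresentationSiegelDetectionOpen`) and `θf` is continuous (★ `omega_conjSplitting_apply`: a FIXED map
  after a locally constant vector-valued family);
* §4 HEAD **`conjSplitting_comp_eq_of_isDoubledWeilRep_of_finPart`**: for `χ`-normalised `sD` (frame `dV`) and `sD″` (frame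
  `dV′`), `conjSplitting r C hC (sD ∘ θ) = sD″` — the twist `η` (★ `adelicMpCont.exists_eq_twist`, algebraic) is `1` on
  `P_Δ′(𝔸)` by the two parabolic clauses, near `1 ∈ H′(𝔸_f)` by smoothness of both sides, hence `1` by
  `eq_one_of_isSiegelDelta_of_nhds_one`; **`conjSplitting_doubledWeilRep_comp_eq_of_finPart`** — the instance
  `sD := doubledWeilRep[dV] χ`, `sD″ := doubledWeilRep[dV′] χ`.
The model instance (doubled Kronecker conjugation `θD` of a rational isometry, `r := r_F(h₀^𝔻)`) is the sequel
`DoubledWeilRepresentationIsometryTransportModel.lean`.  HC_CM is proved only modulo the 7 printed citations until rung 0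
closes; nothing of [Liu2021] is asserted here.

References: [GelbartRogawski1991] S. Gelbart, J. Rogawski, Invent. Math. 105 (1991), §3.1 Prop. 3.1.1 p. 455, Remark
p. 457 L9–13.  [Kudla1994] S. Kudla, Israel J. Math. 87 (1994), §3 Thm. 3.1.  [HarrisKudlaSweet1996] J. Amer. Math. Soc. 9
(1996), §1 (1.9)–(1.15).  [MoeglinVignerasWaldspurger1987] LNM 1291, Chap. 2 II.1, II.8.  [Weil1964] Acta Math. 111 (1964),
Chap. III n° 40–41.
-/

set_option autoImplicit false

noncomputable section

open scoped Classical
open scoped Matrix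
open NumberField IsDedekindDomain
open Literature.RepresentationTheory.HeisenbergGroup
open Literature.NumberTheory.Automorphic
open Literature.NumberTheory.Weil1964
open Literature.NumberTheory.GaloisRepresentations
open Literature.RepresentationTheory.HarrisKudlaSweet1996

namespace Literature.NumberTheory.GelbartRogawski1991.GRConstruction

open UnitaryDualPair
open Literature.NumberTheory.Automorphic.UnitaryGroup (symplecticGroupCongr)
open Literature.NumberTheory.Automorphic.Liu2021.Def411WeilCarriersDoubling

variable (L : Type) [Field L] [NumberField L] [IsCMField L]
  {N M n : ℕ} (e : Fin N × Fin M ≃ Fin n)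
  (dV : Fin N → L) (hdV : ∀ i, IsCMField.complexConj L (dV i) = dV i) (hdV0 : ∀ i, dV i ≠ 0)
  (dV' : Fin N → L) (hdV' : ∀ i, IsCMField.complexConj L (dV' i) = dV' i) (hdV'0 : ∀ i, dV' i ≠ 0)
  (dW : Fin M → L) (hdW : ∀ i, IsCMField.complexConj L (dW i) = dW i) (hdW0 : ∀ i, dW i ≠ 0)

open DoubledWeilUniqueness

section Transport

variable {L e dV hdV hdV0 dV' hdV' hdV'0 dW hdW hdW0}

/-! ## §1 Over `ι′^𝔻`: the group-side square gives `proj_eq` -/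

-- (the `IsDoubledWeilRep` / `conjSplitting` telescopes of BOTH data are compared in `isDefEq`; budget of ★ `DoubledWeilRepresentationRelabel` §3)
/-- **`π′ ∘ conjSplitting r C hC (sD ∘ θ) = ι′^𝔻`** from the group-side square `π(r) · Λ_C ι′^𝔻(h) Λ_C⁻¹ · π(r)⁻¹ = ι^𝔻(θ h)` and
`π ∘ sD = ι^𝔻` (★ `proj_conjSplitting_eq`). [cite: Kudla1984, §1] [cite: MoeglinVignerasWaldspurger1987, Chap. 2 II.1 (A)] -/
theorem proj_conjSplitting_comp (r : MpD L e dV hdV dW hdW) (C : GL (Fin (n + n)) (AdeleRing (𝓞 (Fp L)) (Fp L)))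
    (hC : gramDA L e dV hdV dW hdW * (C : Matrix (Fin (n + n)) (Fin (n + n)) (AdeleRing (𝓞 (Fp L)) (Fp L))) = gramDA L e dV' hdV' dW hdW)
    (θ : HA L e dV' hdV' dW hdW →* HA L e dV hdV dW hdW)
    (hθsq : ∀ h : HA L e dV' hdV' dW hdW,
      projD L e dV hdV dW hdW r *
          symplecticGroupCongr (polar (adelicForm (Fp L) (Fin (n + n)) (gramDA L e dV' hdV' dW hdW)))
            (polar (adelicForm (Fp L) (Fin (n + n)) (gramDA L e dV hdV dW hdW)))
            (relabelVec (Fp L) (Fin (n + n)) C) (polar_relabelVec (Fp L) (Fin (n + n)) C hC)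
            (toSpD L e dV' hdV' dW hdW h) *
        (projD L e dV hdV dW hdW r)⁻¹ = toSpD L e dV hdV dW hdW (θ h))
    (χ : HeckeCharacter L) {sD : HA L e dV hdV dW hdW →* MpD L e dV hdV dW hdW} (hsD : IsDoubledWeilRep L e dV hdV hdV0 dW hdW hdW0 χ sD)
    (h : HA L e dV' hdV' dW hdW) :
    projD L e dV' hdV' dW hdW (conjSplitting (Fp L) (Fin (n + n)) r C hC (sD.comp θ) h) = toSpD L e dV' hdV' dW hdW h :=
  proj_conjSplitting_eq (Fp L) (Fin (n + n)) r C hC (sD.comp θ) (toSpD L e dV' hdV' dW hdW)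
    (fun h' => (hθsq h').trans (hsD.proj_eq (θ h')).symm) h

/-! ## §2 On `P_Δ′(𝔸)`: the `χ`-prescription transports -/

-- (the `IsDoubledWeilRep` / `conjSplitting` telescopes of BOTH data are compared in `isDefEq`; budget of ★ `DoubledWeilRepresentationRelabel` §3)
set_option maxHeartbeats 800000 in -- measured: fails at 200 000, passes at 400 000
/-- **the `χ`-PRESCRIPTION on `P_Δ′(𝔸)` for the conjugated splitting.**  For `p ∈ P_Δ′(𝔸)` with unit `det_Δ`: `θ p ∈ P_Δ(𝔸)` with the same
`det_Δ` (`hθΔ`, `hθdet`), so the source clause gives the scalar `χ(det_Δ p)|det_Δ p|^{1/2}` for `r_Δ sD(θ p) r_Δ⁻¹`; the conjugator transports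
`δ`-evaluation scalars (`hpar` — in the model: `u := R⁻¹ r′_Δ · r⁻¹ · r_Δ⁻¹` lies over a RATIONAL Siegel–Levi element of `P_𝕐` and is `Θ`-fixing,
so `ω(u^{±1})` are evaluation-form with scalar `1`; `R` = the relabelling does not move operators, ★ `omega_relabel`).
[cite: HarrisKudlaSweet1996, §1 (1.14)–(1.15)] [cite: Kudla1994, §2 (doubled space, Siegel parabolic), Thm. 3.1] -/
theorem parabolic_conjSplitting_comp (r : MpD L e dV hdV dW hdW) (C : GL (Fin (n + n)) (AdeleRing (𝓞 (Fp L)) (Fp L)))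
    (hC : gramDA L e dV hdV dW hdW * (C : Matrix (Fin (n + n)) (Fin (n + n)) (AdeleRing (𝓞 (Fp L)) (Fp L))) = gramDA L e dV' hdV' dW hdW)
    (θ : HA L e dV' hdV' dW hdW →* HA L e dV hdV dW hdW)
    (hθΔ : ∀ p, IsSiegelDelta L e dV' hdV' dW hdW p → IsSiegelDelta L e dV hdV dW hdW (θ p))
    (hθdet : ∀ p, IsSiegelDelta L e dV' hdV' dW hdW p → detDelta L e dV hdV dW hdW (θ p) = detDelta L e dV' hdV' dW hdW p)
    (hpar : ∀ (X : MpD L e dV hdV dW hdW) (c : ℂ),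
      (∀ Ψ : piSchwartzBruhat (Fp L) (Fin (n + n)),
        opD L e dV hdV dW hdW (rDelta L e dV hdV hdV0 dW hdW hdW0 * X * (rDelta L e dV hdV hdV0 dW hdW hdW0)⁻¹) Ψ 0 =
          c * (Ψ : (Fin (n + n) → (AdeleRing (𝓞 (Fp L)) (Fp L))) → ℂ) 0) →
      ∀ Φ : piSchwartzBruhat (Fp L) (Fin (n + n)),
        opD L e dV' hdV' dW hdW (rDelta L e dV' hdV' hdV'0 dW hdW hdW0 * conjRelabel (Fp L) (Fin (n + n)) r C hC X *
          (rDelta L e dV' hdV' hdV'0 dW hdW hdW0)⁻¹) Φ 0 = c * (Φ : (Fin (n + n) → (AdeleRing (𝓞 (Fp L)) (Fp L))) → ℂ) 0)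
    (χ : HeckeCharacter L) {sD : HA L e dV hdV dW hdW →* MpD L e dV hdV dW hdW} (hsD : IsDoubledWeilRep L e dV hdV hdV0 dW hdW hdW0 χ sD)
    (p : HA L e dV' hdV' dW hdW) (hp : IsSiegelDelta L e dV' hdV' dW hdW p) (hpu : IsUnit (detDelta L e dV' hdV' dW hdW p))
    (Φ : piSchwartzBruhat (Fp L) (Fin (n + n))) :
    opD L e dV' hdV' dW hdW
        (rDelta L e dV' hdV' hdV'0 dW hdW hdW0 * conjSplitting (Fp L) (Fin (n + n)) r C hC (sD.comp θ) p *
          (rDelta L e dV' hdV' hdV'0 dW hdW hdW0)⁻¹) Φ 0 =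
      ((chiDet L e dV' hdV' dW hdW χ p : ℂˣ) : ℂ) * (modDelta L e dV' hdV' dW hdW p : ℂ) *
        (Φ : (Fin (n + n) → (AdeleRing (𝓞 (Fp L)) (Fp L))) → ℂ) 0 := by
  have hp' : IsSiegelDelta L e dV hdV dW hdW (θ p) := hθΔ p hp
  have hdet : detDelta L e dV hdV dW hdW (θ p) = detDelta L e dV' hdV' dW hdW p := hθdet p hp
  have hpu' : IsUnit (detDelta L e dV hdV dW hdW (θ p)) := hdet ▸ hpu
  have hunit : hpu'.unit = hpu.unit := Units.ext (by rw [IsUnit.unit_spec, IsUnit.unit_spec, hdet])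
  have hchi : chiDet L e dV hdV dW hdW χ (θ p) = chiDet L e dV' hdV' dW hdW χ p := by
    unfold chiDet; rw [dif_pos hpu', dif_pos hpu, hunit]
  have hmod : modDelta L e dV hdV dW hdW (θ p) = modDelta L e dV' hdV' dW hdW p := by
    unfold modDelta; rw [dif_pos hpu', dif_pos hpu, hunit]
  have key : ∀ Ψ : piSchwartzBruhat (Fp L) (Fin (n + n)), opD L e dV hdV dW hdW
      (rDelta L e dV hdV hdV0 dW hdW hdW0 * sD (θ p) * (rDelta L e dV hdV hdV0 dW hdW hdW0)⁻¹) Ψ 0 =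
        ((chiDet L e dV' hdV' dW hdW χ p : ℂˣ) : ℂ) * (modDelta L e dV' hdV' dW hdW p : ℂ) * (Ψ : (Fin (n + n) → (AdeleRing (𝓞 (Fp L)) (Fp L))) → ℂ) 0 :=
    fun Ψ => (hsD.parabolic (θ p) hp' hpu' Ψ).trans (by rw [hchi, hmod])
  exact hpar (sD (θ p)) _ key Φ


end Transport


/-- **the conjugated splitting is smooth on `H′(𝔸_f)`** when the source is and `θ` has a continuous finite part `θf`:
`ω′(conjSplitting r C hC (sD ∘ θ) (1,k)) Ψ = ω(r⁻¹) (ω(sD (1, θf k)) (ω(r) Ψ))` (★ `omega_conjSplitting_apply`) — a FIXED linear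
map after a locally constant VECTOR-valued family. [cite: MoeglinVignerasWaldspurger1987, Chap. 2 II.1 (A), II.8] -/
theorem isLocallyConstant_omega_conjSplitting_finAdelic (r : MpD L e dV hdV dW hdW) (C : GL (Fin (n + n)) (AdeleRing (𝓞 (Fp L)) (Fp L)))
    (hC : gramDA L e dV hdV dW hdW * (C : Matrix (Fin (n + n)) (Fin (n + n)) (AdeleRing (𝓞 (Fp L)) (Fp L))) = gramDA L e dV' hdV' dW hdW)
    (θ : HA L e dV' hdV' dW hdW →* HA L e dV hdV dW hdW)
    (θf : (UnitaryGroup.finAdelic (Fp L) L (IsCMField.complexConj L) (n + n) (hermD L e dV' hdV' dW hdW)) →* (UnitaryGroup.finAdelic (Fp L) L (IsCMField.complexConj L) (n + n) (hermD L e dV hdV dW hdW))) (hθfc : Continuous θf)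
    (hθf : ∀ k, θ ((UnitaryGroup.finAdelicToAdelic (Fp L) L (IsCMField.complexConj L) (n + n) (hermD L e dV' hdV' dW hdW)) k) = (UnitaryGroup.finAdelicToAdelic (Fp L) L (IsCMField.complexConj L) (n + n) (hermD L e dV hdV dW hdW)) (θf k))
    {sD : HA L e dV hdV dW hdW →* MpD L e dV hdV dW hdW}
    (hsm : ∀ Ψ : piSchwartzBruhat (Fp L) (Fin (n + n)), IsLocallyConstant fun k : (UnitaryGroup.finAdelic (Fp L) L (IsCMField.complexConj L) (n + n) (hermD L e dV hdV dW hdW)) =>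
      adelicMpCont.omega (Fp L) (Fin (n + n)) (gramDA L e dV hdV dW hdW) (sD ((UnitaryGroup.finAdelicToAdelic (Fp L) L (IsCMField.complexConj L) (n + n) (hermD L e dV hdV dW hdW)) k)) Ψ)
    (Φ : piSchwartzBruhat (Fp L) (Fin (n + n))) :
    IsLocallyConstant fun k : (UnitaryGroup.finAdelic (Fp L) L (IsCMField.complexConj L) (n + n) (hermD L e dV' hdV' dW hdW)) =>
      adelicMpCont.omega (Fp L) (Fin (n + n)) (gramDA L e dV' hdV' dW hdW)
        (conjSplitting (Fp L) (Fin (n + n)) r C hC (sD.comp θ) ((UnitaryGroup.finAdelicToAdelic (Fp L) L (IsCMField.complexConj L) (n + n) (hermD L e dV' hdV' dW hdW)) k)) Φ := by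
  have hfun : (fun k : (UnitaryGroup.finAdelic (Fp L) L (IsCMField.complexConj L) (n + n) (hermD L e dV' hdV' dW hdW)) =>
      adelicMpCont.omega (Fp L) (Fin (n + n)) (gramDA L e dV' hdV' dW hdW)
        (conjSplitting (Fp L) (Fin (n + n)) r C hC (sD.comp θ) ((UnitaryGroup.finAdelicToAdelic (Fp L) L (IsCMField.complexConj L) (n + n) (hermD L e dV' hdV' dW hdW)) k)) Φ) =
      (fun Ψ => adelicMpCont.omega (Fp L) (Fin (n + n)) (gramDA L e dV hdV dW hdW) r⁻¹ Ψ) ∘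
        ((fun k' : (UnitaryGroup.finAdelic (Fp L) L (IsCMField.complexConj L) (n + n) (hermD L e dV hdV dW hdW)) => adelicMpCont.omega (Fp L) (Fin (n + n)) (gramDA L e dV hdV dW hdW) (sD ((UnitaryGroup.finAdelicToAdelic (Fp L) L (IsCMField.complexConj L) (n + n) (hermD L e dV hdV dW hdW)) k'))
          (adelicMpCont.omega (Fp L) (Fin (n + n)) (gramDA L e dV hdV dW hdW) r Φ)) ∘ θf) := by
    funext k
    exact (omega_conjSplitting_apply (Fp L) (Fin (n + n)) r C hC (sD.comp θ) ((UnitaryGroup.finAdelicToAdelic (Fp L) L (IsCMField.complexConj L) (n + n) (hermD L e dV' hdV' dW hdW)) k) Φ).trans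
      (congrArg (fun h => adelicMpCont.omega (Fp L) (Fin (n + n)) (gramDA L e dV hdV dW hdW) r⁻¹
        (adelicMpCont.omega (Fp L) (Fin (n + n)) (gramDA L e dV hdV dW hdW) (sD h)
          (adelicMpCont.omega (Fp L) (Fin (n + n)) (gramDA L e dV hdV dW hdW) r Φ))) (hθf k))
  rw [hfun]
  exact ((hsm (adelicMpCont.omega (Fp L) (Fin (n + n)) (gramDA L e dV hdV dW hdW) r Φ)).comp_continuous hθfc).comp
    (fun Ψ => adelicMpCont.omega (Fp L) (Fin (n + n)) (gramDA L e dV hdV dW hdW) r⁻¹ Ψ)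


/-! ## §4 (T4c) HEAD: χ-rigidity under the doubled isometry, `hcont`-FREE -/

section Head

variable {L e dV hdV hdV0 dV' hdV' hdV'0 dW hdW hdW0}

/-- `|det_Δ p|^{1/2} ≠ 0` (idelic norms of ideles are non-zero; copy of the tree's private lemma). [folklore] -/
private theorem modDelta_ne_zero' (p : HA L e dV' hdV' dW hdW) : modDelta L e dV' hdV' dW hdW p ≠ 0 := by
  unfold modDelta
  split_ifs with hu
  · rw [← coe_ideleNorm]
    exact Real.sqrt_ne_zero'.mpr (NNReal.coe_pos.mpr (pos_iff_ne_zero.mpr (ideleNorm_ne_zero _)))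
  · exact one_ne_zero

include hdV'0 hdW0 in
/-- **(α2) on CLAUSES**: if `s₂ = s₁ ⊗ η` where `s₁` IS `χ`-normalised and `s₂` merely satisfies the parabolic CLAUSE for `χ`
(no continuity, no `IsDoubledWeilRep s₂`), then `η p = 1` on `P_Δ′(𝔸)` — the (α2) computation of ★ `twist_apply_eq_one_of_isSiegelDelta`
re-typed. [cite: Kudla1994, §3 Thm. 3.1] [cite: HarrisKudlaSweet1996, §1 (1.15)] -/
theorem twist_apply_eq_one_of_isSiegelDelta_of_parabolic (χ : HeckeCharacter L)
    {s₁ s₂ : HA L e dV' hdV' dW hdW →* MpD L e dV' hdV' dW hdW}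
    (h₁ : IsDoubledWeilRep L e dV' hdV' hdV'0 dW hdW hdW0 χ s₁)
    (h₂par : ∀ p, IsSiegelDelta L e dV' hdV' dW hdW p → IsUnit (detDelta L e dV' hdV' dW hdW p) →
      ∀ Φ : piSchwartzBruhat (Fp L) (Fin (n + n)),
        opD L e dV' hdV' dW hdW (rDelta L e dV' hdV' hdV'0 dW hdW hdW0 * s₂ p * (rDelta L e dV' hdV' hdV'0 dW hdW hdW0)⁻¹) Φ 0 =
          ((chiDet L e dV' hdV' dW hdW χ p : ℂˣ) : ℂ) * (modDelta L e dV' hdV' dW hdW p : ℂ) *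
            (Φ : (Fin (n + n) → (AdeleRing (𝓞 (Fp L)) (Fp L))) → ℂ) 0)
    {η : HA L e dV' hdV' dW hdW →* ℂˣ}
    (hη : s₂ = adelicMpCont.twist (Fp L) (Fin (n + n)) (gramDA L e dV' hdV' dW hdW) s₁ η)
    (p : HA L e dV' hdV' dW hdW) (hp : IsSiegelDelta L e dV' hdV' dW hdW p) : η p = 1 := by
  have hu := isUnit_detDelta_of_isSiegelDelta L e dV' hdV' dW hdW p hp
  obtain ⟨Φ, hΦ⟩ := exists_piSchwartzBruhat_apply_zero_ne_zero L (n := n)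
  have e₁ := h₁.parabolic p hp hu Φ
  have e₂ := h₂par p hp hu Φ
  have hc0 : ((chiDet L e dV' hdV' dW hdW χ p : ℂˣ) : ℂ) * (modDelta L e dV' hdV' dW hdW p : ℂ) ≠ 0 :=
    mul_ne_zero (Units.ne_zero _) (Complex.ofReal_ne_zero.mpr (modDelta_ne_zero' p))
  have hp₂ : s₂ p = adelicMpCont.ofScalar (Fp L) (Fin (n + n)) (gramDA L e dV' hdV' dW hdW) (η p) * s₁ p :=
    (DFunLike.congr_fun hη p).trans (adelicMpCont.twist_apply s₁ η p)
  have e₂' := opD_conj_eq_mul_of_eq_ofScalar_mul L e dV' hdV' hdV'0 dW hdW hdW0 p (η p) hp₂ Φ 0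
  have key : ((η p : ℂˣ) : ℂ) * (((chiDet L e dV' hdV' dW hdW χ p : ℂˣ) : ℂ) * (modDelta L e dV' hdV' dW hdW p : ℂ) *
        (Φ : (Fin (n + n) → (AdeleRing (𝓞 (Fp L)) (Fp L))) → ℂ) 0) =
      1 * (((chiDet L e dV' hdV' dW hdW χ p : ℂˣ) : ℂ) * (modDelta L e dV' hdV' dW hdW p : ℂ) *
        (Φ : (Fin (n + n) → (AdeleRing (𝓞 (Fp L)) (Fp L))) → ℂ) 0) :=
    ((congrArg (fun z => ((η p : ℂˣ) : ℂ) * z) e₁).symm.trans (e₂'.symm.trans e₂)).trans (one_mul _).symm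
  exact Units.val_eq_one.mp (mul_right_cancel₀ (mul_ne_zero hc0 hΦ) key)

include hdV0 hdW0 in
-- (the `IsDoubledWeilRep` / `conjSplitting` telescopes of BOTH data are compared in `isDefEq`; budget of B-p08's probe ×4)
set_option maxHeartbeats 4000000 in -- measured: fails at 1 600 000, passes at 3 200 000
/-- **(T4c) — THE EQUALITY WITHOUT `hcont`.**  With B-p08's conjugation datum `(r, C, hC, θ, hθsq, hθΔ, hθdet, hpar)` and the
continuous finite part `θf` of `θ` (`hθf`): the conjugated `χ`-splitting of `H` IS any `χ`-normalised splitting `sD″` of `H′`.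
`η` algebraic (★ `adelicMpCont.exists_eq_twist` on B-p08 `proj_conjSplitting_comp` + `hsD″.proj_eq`); `η = 1` on `P_Δ′(𝔸)`
((α2) on clauses: B-p08 `parabolic_conjSplitting_comp`); §3 ⇒ §2 ⇒ §1.
[cite: GelbartRogawski1991, §3.1 Prop. 3.1.1 p. 455 L1–2, Remark p. 457] [cite: Kudla1994, §3 Thm. 3.1] -/
theorem conjSplitting_comp_eq_of_isDoubledWeilRep_of_finPart (r : MpD L e dV hdV dW hdW) (C : GL (Fin (n + n)) (AdeleRing (𝓞 (Fp L)) (Fp L)))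
    (hC : gramDA L e dV hdV dW hdW * (C : Matrix (Fin (n + n)) (Fin (n + n)) (AdeleRing (𝓞 (Fp L)) (Fp L))) = gramDA L e dV' hdV' dW hdW)
    (θ : HA L e dV' hdV' dW hdW →* HA L e dV hdV dW hdW)
    (hθsq : ∀ h : HA L e dV' hdV' dW hdW,
      projD L e dV hdV dW hdW r *
          symplecticGroupCongr (polar (adelicForm (Fp L) (Fin (n + n)) (gramDA L e dV' hdV' dW hdW)))
            (polar (adelicForm (Fp L) (Fin (n + n)) (gramDA L e dV hdV dW hdW)))
            (relabelVec (Fp L) (Fin (n + n)) C) (polar_relabelVec (Fp L) (Fin (n + n)) C hC)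
            (toSpD L e dV' hdV' dW hdW h) *
        (projD L e dV hdV dW hdW r)⁻¹ = toSpD L e dV hdV dW hdW (θ h))
    (hθΔ : ∀ p, IsSiegelDelta L e dV' hdV' dW hdW p → IsSiegelDelta L e dV hdV dW hdW (θ p))
    (hθdet : ∀ p, IsSiegelDelta L e dV' hdV' dW hdW p → detDelta L e dV hdV dW hdW (θ p) = detDelta L e dV' hdV' dW hdW p)
    (hpar : ∀ (X : MpD L e dV hdV dW hdW) (c : ℂ),
      (∀ Ψ : piSchwartzBruhat (Fp L) (Fin (n + n)),
        opD L e dV hdV dW hdW (rDelta L e dV hdV hdV0 dW hdW hdW0 * X * (rDelta L e dV hdV hdV0 dW hdW hdW0)⁻¹) Ψ 0 =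
          c * (Ψ : (Fin (n + n) → (AdeleRing (𝓞 (Fp L)) (Fp L))) → ℂ) 0) →
      ∀ Φ : piSchwartzBruhat (Fp L) (Fin (n + n)),
        opD L e dV' hdV' dW hdW (rDelta L e dV' hdV' hdV'0 dW hdW hdW0 * conjRelabel (Fp L) (Fin (n + n)) r C hC X *
          (rDelta L e dV' hdV' hdV'0 dW hdW hdW0)⁻¹) Φ 0 = c * (Φ : (Fin (n + n) → (AdeleRing (𝓞 (Fp L)) (Fp L))) → ℂ) 0)
    (θf : (UnitaryGroup.finAdelic (Fp L) L (IsCMField.complexConj L) (n + n) (hermD L e dV' hdV' dW hdW)) →* (UnitaryGroup.finAdelic (Fp L) L (IsCMField.complexConj L) (n + n) (hermD L e dV hdV dW hdW))) (hθfc : Continuous θf)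
    (hθf : ∀ k, θ ((UnitaryGroup.finAdelicToAdelic (Fp L) L (IsCMField.complexConj L) (n + n) (hermD L e dV' hdV' dW hdW)) k) = (UnitaryGroup.finAdelicToAdelic (Fp L) L (IsCMField.complexConj L) (n + n) (hermD L e dV hdV dW hdW)) (θf k))
    (χ : HeckeCharacter L) (hχu : χ.IsUnitary) (hχs : IsSplittingChar L 1 χ)
    {sD : HA L e dV hdV dW hdW →* MpD L e dV hdV dW hdW} (hsD : IsDoubledWeilRep L e dV hdV hdV0 dW hdW hdW0 χ sD)
    {sD'' : HA L e dV' hdV' dW hdW →* MpD L e dV' hdV' dW hdW}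
    (hsD'' : IsDoubledWeilRep L e dV' hdV' hdV'0 dW hdW hdW0 χ sD'') :
    conjSplitting (Fp L) (Fin (n + n)) r C hC (sD.comp θ) = sD'' := by
  -- (i) the algebraic twist `conjSplitting … = sD″ ⊗ η`
  have hproj : ∀ h, projD L e dV' hdV' dW hdW (sD'' h) =
      projD L e dV' hdV' dW hdW (conjSplitting (Fp L) (Fin (n + n)) r C hC (sD.comp θ) h) := fun h =>
    (hsD''.proj_eq h).trans (proj_conjSplitting_comp r C hC θ hθsq χ hsD h).symm
  obtain ⟨η, hη⟩ := adelicMpCont.exists_eq_twist sD'' (conjSplitting (Fp L) (Fin (n + n)) r C hC (sD.comp θ))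
    (isUnit_gramDA L e dV' hdV' hdV'0 dW hdW hdW0) hproj
  -- (ii) `η = 1` on `P_Δ′(𝔸)`
  have hP : ∀ p, IsSiegelDelta L e dV' hdV' dW hdW p → η p = 1 := fun p hp =>
    twist_apply_eq_one_of_isSiegelDelta_of_parabolic χ hsD''
      (fun p hp hpu Φ => parabolic_conjSplitting_comp r C hC θ hθΔ hθdet hpar χ hsD p hp hpu Φ) hη p hp
  -- (iii′) `η = 1` near `1 ∈ H′(𝔸_f)`
  obtain ⟨Φ₀, hΦ₀0⟩ := exists_piSchwartzBruhat_apply_zero_ne_zero L (n := n)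
  have hΦ₀ : Φ₀ ≠ 0 := fun h => hΦ₀0 (by rw [h]; rfl)
  have hl₁ := isLocallyConstant_omega_conjSplitting_finAdelic L e dV hdV dV' hdV' dW hdW r C hC θ θf hθfc hθf
    (isLocallyConstant_omega_finAdelic_of_isDoubledWeilRep L e dV hdV hdV0 dW hdW hdW0 χ hχu hχs hsD) Φ₀
  have hl₂ := isLocallyConstant_omega_finAdelic_of_isDoubledWeilRep L e dV' hdV' hdV'0 dW hdW hdW0 χ hχu hχs hsD'' Φ₀
  have hηf : (conjSplitting (Fp L) (Fin (n + n)) r C hC (sD.comp θ)).comp ((UnitaryGroup.finAdelicToAdelic (Fp L) L (IsCMField.complexConj L) (n + n) (hermD L e dV' hdV' dW hdW))) =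
      adelicMpCont.twist (Fp L) (Fin (n + n)) (gramDA L e dV' hdV' dW hdW) (sD''.comp ((UnitaryGroup.finAdelicToAdelic (Fp L) L (IsCMField.complexConj L) (n + n) (hermD L e dV' hdV' dW hdW))))
        (η.comp ((UnitaryGroup.finAdelicToAdelic (Fp L) L (IsCMField.complexConj L) (n + n) (hermD L e dV' hdV' dW hdW)))) :=
    MonoidHom.ext fun k => (DFunLike.congr_fun hη ((UnitaryGroup.finAdelicToAdelic (Fp L) L (IsCMField.complexConj L) (n + n) (hermD L e dV' hdV' dW hdW)) k)).trans
      ((adelicMpCont.twist_apply sD'' η ((UnitaryGroup.finAdelicToAdelic (Fp L) L (IsCMField.complexConj L) (n + n) (hermD L e dV' hdV' dW hdW)) k)).trans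
        (adelicMpCont.twist_apply (sD''.comp ((UnitaryGroup.finAdelicToAdelic (Fp L) L (IsCMField.complexConj L) (n + n) (hermD L e dV' hdV' dW hdW)))) (η.comp ((UnitaryGroup.finAdelicToAdelic (Fp L) L (IsCMField.complexConj L) (n + n) (hermD L e dV' hdV' dW hdW)))) k).symm)
  obtain ⟨U, hU1, hUη⟩ := twist_eq_one_nhds_one_of_isLocallyConstant L hηf Φ₀ hΦ₀ hl₁ hl₂
  -- (iv) Siegel detection, `hcont`-free
  have hη1 : η = 1 :=
    eq_one_of_isSiegelDelta_of_nhds_one L e dV' hdV' hdV'0 dW hdW hdW0 η hP ⟨U, hU1, fun k hk => hUη k hk⟩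
  refine hη.trans ((congrArg (adelicMpCont.twist (Fp L) (Fin (n + n)) (gramDA L e dV' hdV' dW hdW) sD'') hη1).trans
    (MonoidHom.ext fun h => (adelicMpCont.twist_apply sD'' 1 h).trans ?_))
  exact (congrArg (fun c => c * sD'' h)
    (map_one (adelicMpCont.ofScalar (Fp L) (Fin (n + n)) (gramDA L e dV' hdV' dW hdW)))).trans (one_mul (sD'' h))

include hdV0 hdW0 in
-- (same telescope budget)
/-- **(T4c) at the splittings of record**: `conjSplitting r C hC (doubledWeilRep[dV] χ ∘ θ) = doubledWeilRep[dV′] χ`, `hcont`-FREE.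
[cite: Liu2021, Thm. 4.15 proof l. 2199–2210] [cite: HarrisKudlaSweet1996, §1 (1.14)–(1.15), Cor. A.3 p. 998] -/
theorem conjSplitting_doubledWeilRep_comp_eq_of_finPart (r : MpD L e dV hdV dW hdW) (C : GL (Fin (n + n)) (AdeleRing (𝓞 (Fp L)) (Fp L)))
    (hC : gramDA L e dV hdV dW hdW * (C : Matrix (Fin (n + n)) (Fin (n + n)) (AdeleRing (𝓞 (Fp L)) (Fp L))) = gramDA L e dV' hdV' dW hdW)
    (θ : HA L e dV' hdV' dW hdW →* HA L e dV hdV dW hdW)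
    (hθsq : ∀ h : HA L e dV' hdV' dW hdW,
      projD L e dV hdV dW hdW r *
          symplecticGroupCongr (polar (adelicForm (Fp L) (Fin (n + n)) (gramDA L e dV' hdV' dW hdW)))
            (polar (adelicForm (Fp L) (Fin (n + n)) (gramDA L e dV hdV dW hdW)))
            (relabelVec (Fp L) (Fin (n + n)) C) (polar_relabelVec (Fp L) (Fin (n + n)) C hC)
            (toSpD L e dV' hdV' dW hdW h) *
        (projD L e dV hdV dW hdW r)⁻¹ = toSpD L e dV hdV dW hdW (θ h))
    (hθΔ : ∀ p, IsSiegelDelta L e dV' hdV' dW hdW p → IsSiegelDelta L e dV hdV dW hdW (θ p))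
    (hθdet : ∀ p, IsSiegelDelta L e dV' hdV' dW hdW p → detDelta L e dV hdV dW hdW (θ p) = detDelta L e dV' hdV' dW hdW p)
    (hpar : ∀ (X : MpD L e dV hdV dW hdW) (c : ℂ),
      (∀ Ψ : piSchwartzBruhat (Fp L) (Fin (n + n)),
        opD L e dV hdV dW hdW (rDelta L e dV hdV hdV0 dW hdW hdW0 * X * (rDelta L e dV hdV hdV0 dW hdW hdW0)⁻¹) Ψ 0 =
          c * (Ψ : (Fin (n + n) → (AdeleRing (𝓞 (Fp L)) (Fp L))) → ℂ) 0) →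
      ∀ Φ : piSchwartzBruhat (Fp L) (Fin (n + n)),
        opD L e dV' hdV' dW hdW (rDelta L e dV' hdV' hdV'0 dW hdW hdW0 * conjRelabel (Fp L) (Fin (n + n)) r C hC X *
          (rDelta L e dV' hdV' hdV'0 dW hdW hdW0)⁻¹) Φ 0 = c * (Φ : (Fin (n + n) → (AdeleRing (𝓞 (Fp L)) (Fp L))) → ℂ) 0)
    (θf : (UnitaryGroup.finAdelic (Fp L) L (IsCMField.complexConj L) (n + n) (hermD L e dV' hdV' dW hdW)) →* (UnitaryGroup.finAdelic (Fp L) L (IsCMField.complexConj L) (n + n) (hermD L e dV hdV dW hdW))) (hθfc : Continuous θf)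
    (hθf : ∀ k, θ ((UnitaryGroup.finAdelicToAdelic (Fp L) L (IsCMField.complexConj L) (n + n) (hermD L e dV' hdV' dW hdW)) k) = (UnitaryGroup.finAdelicToAdelic (Fp L) L (IsCMField.complexConj L) (n + n) (hermD L e dV hdV dW hdW)) (θf k))
    (χ : HeckeCharacter L) (hχu : χ.IsUnitary) (hχs : IsSplittingChar L 1 χ) :
    conjSplitting (Fp L) (Fin (n + n)) r C hC ((doubledWeilRep L e dV hdV hdV0 dW hdW hdW0 χ hχu hχs).comp θ) =
      doubledWeilRep L e dV' hdV' hdV'0 dW hdW hdW0 χ hχu hχs :=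
  conjSplitting_comp_eq_of_isDoubledWeilRep_of_finPart r C hC θ hθsq hθΔ hθdet hpar θf hθfc hθf χ hχu hχs
    (isDoubledWeilRep_doubledWeilRep L e dV hdV hdV0 dW hdW hdW0 χ hχu hχs)
    (isDoubledWeilRep_doubledWeilRep L e dV' hdV' hdV'0 dW hdW hdW0 χ hχu hχs)

end Head

end Literature.NumberTheory.GelbartRogawski1991.GRConstruction

end
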